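import Literature.Geometry.Riemannian.SurgeryOnManifold
import Literature.Geometry.Riemannian.SurgeryDistance
import Literature.Geometry.Riemannian.CurvatureLocality
import Literature.Geometry.Riemannian.WeinsteinCriterion
import Literature.Geometry.Riemannian.SectionalCurvatureCompactBound
import Literature.Geometry.Riemannian.TangentCutLocusSubanalytic
import HarnessLib

/-!
# Weinstein's surgery yields multiplicity `≥ 2` on the cut locus

Topic `Geometry/Riemannian`. The conclusion of the metric part of Weinstein 1968 (proof of the
main theorem, steps (2)–(3), for the disk delivered by step (1)): given, on a compact connected
manifold `(M, g₀)`, the round model of a thin tube (a model open set `U ⊆ V` whose chart metric is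
the pullback of `g₀` under a `C^∞` injective immersion `Φ_A`, with the normalisation and the
Christoffel bound of the boundary sphere for the constant `λ`), such that every point of `M` is at
`g₀`-distance `< θ` from `Φ_A(closed unit ball)`, and `λ θ + max Λ₀ 0 · θ² < 1` for a bound
`Λ₀` of the sectional curvatures of `g₀`, **the modified metric `g₁` of the surgery has a point
`p` all of whose cut points are joined to `p` by at least two minimal geodesics**
(`exists_metric_two_le_multiplicity_of_surgery`): `SurgeryOnManifold.exists_surgery_data_onto`
supplies the data of `WeinsteinCriterion.two_le_minimalGeodesicMultiplicity_of_radial`; the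
curvature hypothesis off the disk holds because `g₁ = g₀` there (`CurvatureLocality.lean`), and the
thinness hypothesis for `g₁` follows from the `θ`-density for `g₀` (`SurgeryDistance.lean`).

## References

* A. Weinstein, *The cut locus and conjugate locus of a Riemannian manifold*, Ann. of Math. (2)
  87 (1968), 29–41, proof of the main theorem. [cite: Weinstein1968]

Tags: [CutLocus] [Surgery] [Weinstein1968]
-/

noncomputable section

open Bundle Set Function Filter TopologicalSpace Metric Module
open scoped Manifold ContDiff Topology RealInnerProductSpace ENNReal

namespace Literature.Geometry.Riemannian

open Literature.Geometry.Lorentzian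
open Literature.Geometry.Lorentzian.OpensChart
open Literature.Geometry.Lorentzian.PseudoRiemannianMetric

variable {E : Type*} [NormedAddCommGroup E] [NormedSpace ℝ E] [FiniteDimensional ℝ E]
  [CompleteSpace E] {H : Type*} [TopologicalSpace H] {I : ModelWithCorners ℝ E H} [I.Boundaryless]
  {M : Type*} [TopologicalSpace M] [ChartedSpace H M] [IsManifold I ∞ M] [T2Space M]
  [CompactSpace M] [ConnectedSpace M]
  (g₀ : PseudoRiemannianMetric I ∞ E (TangentSpace I : M → Type _)) [g₀.HasLeviCivita]
  {V : Type*} [NormedAddCommGroup V] [InnerProductSpace ℝ V] [FiniteDimensional ℝ V]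
  {U : Opens V}
  (gU : PseudoRiemannianMetric 𝓘(ℝ, V) ∞ V (TangentSpace 𝓘(ℝ, V) : U → Type _)) [gU.HasLeviCivita]
  (GU : V → V →L[ℝ] V →L[ℝ] ℝ)

set_option maxHeartbeats 3200000 in
/-- **Weinstein's surgery: multiplicity `≥ 2` on the cut locus of the centre.** See the module
docstring. [cite: Weinstein1968, proof of the main theorem] -/
theorem exists_metric_two_le_multiplicity_of_surgery {d : ℕ} (hdimE : finrank ℝ V = d + 1)
    (hVE : finrank ℝ V = finrank ℝ E)
    (hG : ∀ y : U, gU.val y = GU y) (hgU : gU.IsRiemannian) (u₀ : U) {εU : ℝ} (hεU : 0 < εU)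
    (hUball : ball (0 : V) (1 + εU) ⊆ (U : Set V))
    {ΦA : V → M} (hΦs : ContMDiffOn 𝓘(ℝ, V) I ∞ ΦA U) (hΦinj : InjOn ΦA U)
    (hΦd : ∀ y ∈ (U : Set V), Injective (mfderiv 𝓘(ℝ, V) I ΦA y))
    (hpb : ∀ y ∈ (U : Set V), ∀ u w : V,
      GU y u w = g₀.val (ΦA y) (mfderiv 𝓘(ℝ, V) I ΦA y u) (mfderiv 𝓘(ℝ, V) I ΦA y w))
    (hq1 : ∀ p : U, ‖(p : V)‖ = 1 →
      1 ≤ GU p ((GU p).inverse (innerSL ℝ (p : V))) ((GU p).inverse (innerSL ℝ (p : V))))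
    {lam : ℝ} (hlam : 0 ≤ lam)
    (hΓ : ∀ p : U, ‖(p : V)‖ = 1 → ∀ X : V,
      ⟪(p : V), christoffel gU GU p X X⟫ ≤
        lam * Real.sqrt (GU p ((GU p).inverse (innerSL ℝ (p : V))) ((GU p).inverse (innerSL ℝ (p : V)))) *
          GU p X X)
    (hg₀ : g₀.IsRiemannian) {θ Λ₀ : ℝ} (hθ : 0 < θ)
    (hΛ₀ : ∀ (x : M) (X Y : TangentSpace I x),
      g₀.curvatureForm g₀.leviCivita x X Y Y X ≤ Λ₀ * (g₀.val x X X * g₀.val x Y Y - g₀.val x X Y ^ 2))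
    (hnet : ∀ x : M, ∃ q ∈ ΦA '' closedBall (0 : V) 1, g₀.edist hg₀ x q < ENNReal.ofReal θ)
    (hsmall : lam * θ + max Λ₀ 0 * θ ^ 2 < 1) :
    ∃ (g₁ : PseudoRiemannianMetric I ∞ E (TangentSpace I : M → Type _)) (hg₁ : g₁.IsRiemannian) (p : M),
      ∀ q ∈ cutLocus g₁ hg₁ p, 2 ≤ minimalGeodesicMultiplicity g₁ hg₁ p q := by
  obtain ⟨g₁, F, r₁, hg₁, hr₁, hF0, hFs, hdF0, hinj, hdF, hrad, hgauss, hexit, ⟨K, hKc, hKout, hKin⟩,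
    honto⟩ := exists_surgery_data_onto g₀ gU GU hdimE hVE hG hgU u₀ hεU hUball hΦs hΦinj hΦd hpb hq1
      hlam hΓ hg₀
  haveI : g₁.HasLeviCivita := g₁.hasLeviCivita
  haveI : CovariantDerivative.ContMDiffCovariantDerivative g₁.leviCivita ∞ :=
    contMDiffCovariantDerivative_leviCivita_infty g₁ le_rfl
  haveI : CovariantDerivative.ContMDiffCovariantDerivative g₁.leviCivita 1 :=
    ⟨g₁.isLocallyContMDiff_leviCivita_holds 1 (by exact_mod_cast le_top) univ isOpen_univ⟩
  set p : M := ΦA 0 with hp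
  refine ⟨g₁, hg₁, p, ?_⟩
  have hc : IsGeodesicallyComplete g₁.leviCivita := hopfRinow_compact_geodesicallyComplete le_rfl hg₁
  have hr₁pos : 0 < r₁ := by linarith
  /- ── `d₁(p, F v) ≤ |v|_{g₁(p)}` on the ball ── -/
  have hedist : ∀ v : E, g₁.val p v v < r₁ ^ 2 →
      g₁.edist hg₁ p (F v) ≤ ENNReal.ofReal (Real.sqrt (g₁.val p v v)) := by
    intro v hv
    have h := riemannianExpMap_eq_of_radial (g := g₁) le_rfl hg₁ hc hr₁pos hFs hF0 hdF0 hinj hdF hrad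
      hgauss hv
    rw [← h, riemannianExpMap_eq]
    exact edist_expMap_le_sqrt g₁ hg₁ hc p v
  /- ── the compact set `Kc = F({|v| ≤ 1}) ⊇ K` ── -/
  set G : E →L[ℝ] E →L[ℝ] ℝ := g₁.val p with hGdef
  have hnn : ∀ v : E, 0 ≤ G v v := fun v ↦ by
    by_cases hv0 : v = 0
    · rw [hv0, map_zero]
    · exact (hg₁ p v hv0).le
  set B1 : Set E := {v : E | g₁.val p v v ≤ 1} with hB1
  have hB1c : IsCompact B1 := by
    haveI : ProperSpace E := FiniteDimensional.proper ℝ E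
    obtain ⟨c, hcpos, hcv⟩ := exists_pos_mul_norm_sq_le_of_pos_def G (fun v hv ↦ hg₁ p v hv)
    have hcont : Continuous fun v : E ↦ G v v :=
      G.continuous₂.comp (continuous_id.prodMk continuous_id)
    apply Metric.isCompact_of_isClosed_isBounded (isClosed_le hcont continuous_const)
    rw [Metric.isBounded_iff_subset_closedBall (0 : E)]
    refine ⟨Real.sqrt c⁻¹, fun v hv ↦ ?_⟩
    rw [mem_closedBall, dist_zero_right, Real.le_sqrt (norm_nonneg _) (inv_nonneg.2 hcpos.le)]
    have h1 : c * ‖v‖ ^ 2 ≤ 1 := (hcv v).trans hv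
    calc ‖v‖ ^ 2 = (c * ‖v‖ ^ 2) * c⁻¹ := by field_simp
      _ ≤ 1 * c⁻¹ := mul_le_mul_of_nonneg_right h1 (inv_nonneg.2 hcpos.le)
      _ = c⁻¹ := one_mul _
  have hB1sub : B1 ⊆ {v : E | g₁.val p v v < r₁ ^ 2} := fun v hv ↦ by
    have hv' : g₁.val p v v ≤ 1 := hv
    show g₁.val p v v < r₁ ^ 2
    nlinarith
  set Kc : Set M := F '' B1 with hKcdef
  have hKcc : IsCompact Kc := hB1c.image_of_continuousOn (hFs.continuousOn.mono hB1sub)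
  have hKcl : IsClosed Kc := hKcc.isClosed
  have hKKc : K ⊆ Kc := by
    intro x hx
    obtain ⟨v, hv, rfl⟩ := hKin x hx
    exact ⟨v, le_of_lt hv, rfl⟩
  have heqKc : ∀ y : M, y ∉ Kc → g₁.val y = g₀.val y := fun y hy ↦ hKout y (fun h ↦ hy (hKKc h))
  have hKc1 : ∀ y ∈ Kc, g₁.edist hg₁ p y ≤ ENNReal.ofReal 1 := by
    rintro _ ⟨v, hv, rfl⟩
    refine (hedist v (hB1sub hv)).trans (ENNReal.ofReal_le_ofReal ?_)
    rw [show (1 : ℝ) = Real.sqrt 1 from Real.sqrt_one.symm]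
    exact Real.sqrt_le_sqrt hv
  /- ── the criterion ── -/
  refine two_le_minimalGeodesicMultiplicity_of_radial (g := g₁) le_rfl hg₁ (p := p) (F := F)
    (r₁ := r₁) (R := 1) (θ := θ) (lam := lam) (Λ := Λ₀) one_pos hr₁ hθ.le hlam hFs hF0 hdF0 hinj hdF
    hrad hgauss hexit ?_ ?_ hsmall
  · -- curvature off the disk: there `g₁ = g₀`
    intro x hx X Y
    have hxK : x ∉ K := by
      intro hxK
      obtain ⟨v, hv, rfl⟩ := hKin x hxK
      have h1 := hedist v (by nlinarith [hr₁])
      have h2 : ENNReal.ofReal (Real.sqrt (g₁.val p v v)) < ENNReal.ofReal 1 := by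
        rw [ENNReal.ofReal_lt_ofReal_iff one_pos]
        rw [show (1 : ℝ) = Real.sqrt 1 from Real.sqrt_one.symm]
        exact Real.sqrt_lt_sqrt (hnn v) hv
      exact absurd (hx.trans h1) (not_le.2 h2)
    have hev : ∀ᶠ y in 𝓝 x, g₁.val y = g₀.val y := by
      filter_upwards [hKc.isClosed.isOpen_compl.mem_nhds hxK] with y hy
      exact hKout y hy
    rw [curvatureForm_eq_of_eventuallyEq g₁ g₀ hev X Y Y X, hKout x hxK]
    exact hΛ₀ x X Y
  · -- thinness for `g₁` from `θ`-density for `g₀`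
    intro x
    obtain ⟨q, hq, hxq⟩ := hnet x
    have hqKc : q ∈ Kc := honto hq
    obtain ⟨y, hyKc, hxy⟩ := exists_mem_edist_lt_of_val_eq_off g₀ g₁ hg₀ hg₁ hKcl heqKc hqKc hxq
    exact ⟨y, hKc1 y hyKc, hxy.le⟩

end Literature.Geometry.Riemannian

end
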